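import Literature.Analysis.FluidPDE.NormalisedPressureL2Bound
import Literature.Analysis.FluidPDE.PressureRepresentation
import Literature.Analysis.FluidPDE.LerayProfileCalculus
import Literature.Analysis.FluidPDE.HarmonicBallMeanValue
import Literature.Analysis.FluidPDE.WeightedVelocityBounds
import HarnessLib

/-!
# Local control of the pressure of a Leray profile: `‖P − c‖_{L^p(B(x₀,ρ))} ≤ K (1 + |x₀|)`

Analysis/FluidPDE proofs layer for the decomposition of the named fact
`Literature.Analysis.FluidPDE.tsai1998_lemma32` (`FluidPDE/TsaiGrowthLemmas`; T.-P. Tsai, *On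
Leray's self-similar solutions of the Navier–Stokes equations satisfying local energy
estimates*, Arch. Rational Mech. Anal. 143 (1998) 29–51, **Lemma 3.2**: polynomial growth of the
pressure `P` of a profile `(U, P)` of Leray's system (1.3) with `U ∈ L^q((EuclideanSpace ℝ (Fin 3)))`).

## What is proved here, and how it replaces Tsai's Lemma 2.1

The starting point of Tsai's growth estimates (Lemma 3.1, p. 37: "Since `‖U‖_{3,B₂}` and
`‖P‖_{3/2,B₂}` tend to zero as `y₀` goes to infinity (we recall that `P` is defined by (2.2))")
is a *local* `L^{3/2}` control of the pressure, which in print comes from the *global*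
identification `P = P̃ + const`, `P̃ = RᵢRⱼ(UᵢUⱼ) ∈ L^{q/2}` (Lemma 2.1: Calderón–Zygmund, and a
Liouville argument for the harmonic vector `∇P̃ − ∇P`; for `q = ∞`, BMO and the `H¹`–BMO
pairing). For the smooth profiles of the tree we prove the local control directly, for every
`2 ≤ q ≤ ∞` at once and with linear growth in the centre:

**Theorem** (`IsLerayProfile.exists_local_pressure_bound`). Let `ν > 0`, `a ∈ ℝ`,
`(U, P)` a Leray profile with `U ∈ C^∞ ∩ L^q((EuclideanSpace ℝ (Fin 3)))`, and suppose the normalised pressures of the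
localised fields `θ_{x₀}U` are bounded in some `L^p`, `1 < p < ∞`, uniformly in `x₀`. Then for
every radius `ρ > 0` there is `K` such that for every centre `x₀` there is a constant `c` with
`‖P − c‖_{L^p(B(x₀, ρ))} ≤ K (1 + |x₀|)`.

*Proof.* Fix `x₀` and let `θ = θ_{x₀}` be a smooth cutoff equal to `1` on `B̄(x₀, 4ρ)` and
supported in `B̄(x₀, 8ρ)`, `v = θU ∈ C^∞_c`, and `N = p̃[v]` its normalised pressure
(`FluidPDE/NormalisedPressure`), which is the Newtonian potential `Q[v]` of
`FluidPDE/PressureRepresentation` with `ΔN = −∂ᵢ∂ⱼ(vᵢvⱼ)` (`laplacian_pressurePotential`).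
By the pressure Poisson equation of the profile (`ΔP = −tr (DU∘DU) = −∂ᵢ∂ⱼ(UᵢUⱼ)`,
`FluidPDE/LerayProfileCalculus`) the difference `h = P − N` is **harmonic on `B(x₀, 4ρ)`**.
For `y ∈ B̄(x₀, ρ)` the gradient formula on a ball (`FluidPDE/HarmonicBallMeanValue`, weight
`λ = λ^{ρ,2ρ}` supported in `|z| ≤ 2ρ`) gives
`Dh(y) a = ∫ λ(z) ∂ₐP(y − z) dz − ∫ ∂ₐλ(z) N(y − z) dz`.
In the first integral `∂ₐP = ⟪νΔU − aU − a(y·∇)U − (U·∇)U, a⟫` by Leray's system, and moving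
every derivative onto the weight (`FluidPDE/WeightedVelocityBounds`) bounds it by
`C (1 + |x₀|) (∫_{B̄(y,2ρ)} |U| + ∫_{B̄(y,2ρ)} |U|²)`, the factor `|x₀|` coming only from the drift
`a(y·∇)U`; the second is at most `sup|Dλ| ∫_{B̄(y,2ρ)} |N|`. Both are bounded uniformly in the
centre by the global `L^q` bound on `U` and the `L^p` bound on `N`. Hence
`sup_{B̄(x₀,ρ)} |∇h| ≤ K₁ (1 + |x₀|)`, so `|h − h(x₀)| ≤ K₁ (1 + |x₀|) ρ` on the ball, and
`‖P − h(x₀)‖_{L^p(B(x₀,ρ))} ≤ ‖h − h(x₀)‖_{L^p} + ‖N‖_{L^p} ≤ K (1 + |x₀|)`. ∎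

The `L^p` bound on the localised normalised pressures holds with `p = 2` whenever `q ≥ 4` by
the tree's **proved** `L²` bound `‖p̃[w]‖_{L²} ≤ C ‖|w|²‖_{L²}` (`NormalisedPressureL2Bound`,
`eLpNorm_normalisedPressure_le`; `‖|θU|²‖_{L²} ≤ ‖U‖²_{L⁴(B(x₀,8ρ))} ≤ C ‖U‖²_{L^q}`), and with
`p = q/2` for `2 < q < ∞` from the named fact `stein1970_normalisedPressure_Lp_bound`
(`NormalisedPressureLpBound`; Stein 1970, II §4.2 Thm 3), which is what Tsai's (2.3) uses for
`3 ≤ q < 4`. The first instantiation is `…_of_four_le` below; the second is performed where it is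
consumed (`FluidPDE/TsaiPressureGrowth`), so that this file does not depend on the named fact.

## Main statements

* `IsLerayProfile.laplacian_pressure_sub_localPressure_eq_zero`: `Δ(P − p̃[θ_{x₀}U]) = 0` on
  `B(x₀, 4ρ)`.
* `IsLerayProfile.norm_fderiv_pressure_sub_localPressure_le`: the interior gradient bound
  `‖D(P − p̃[θ_{x₀}U])(y)‖ ≤ K₁ (1 + |x₀|)` on `B̄(x₀, ρ)`, with `K₁` explicit in the data.
* `IsLerayProfile.exists_local_pressure_bound`: the theorem above (gradient bound on `B̄(x₀, ρ)`
  and `L^p` bound on `B(x₀, ρ)`, uniformly linear in `|x₀|`).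
* `exists_eLpNorm_two_normalisedPressure_locF_le`,
  `IsLerayProfile.exists_local_pressure_bound_of_four_le`: the unconditional `L²` instance for
  `4 ≤ q ≤ ∞`.

## References

* T.-P. Tsai, *On Leray's self-similar solutions of the Navier–Stokes equations satisfying local
  energy estimates*, Arch. Rational Mech. Anal. 143 (1998): Lemma 2.1 and its proof (pp. 34–36),
  Lemma 3.1 (p. 37), Remark 3.1, and the use of (2.2)–(2.4) in §3.2 (pp. 38–39) [Tsai1998].
* E. M. Stein, *Singular integrals and differentiability properties of functions* (1970), Ch. II
  §4.2 Thm 3 [Stein1971].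
* D. Gilbarg, N. S. Trudinger, *Elliptic partial differential equations of second order* (2001),
  Thm 2.10 (interior gradient estimates for harmonic functions) [GilbargTrudinger2001].
-/

noncomputable section

open MeasureTheory Set Function Filter Topology InnerProductSpace Metric
open scoped RealInnerProductSpace Laplacian ContDiff ENNReal NNReal

namespace Literature.Analysis.FluidPDE

section LocalPressure

-- nested operator types `(EuclideanSpace ℝ (Fin 3)) →L[ℝ] (EuclideanSpace ℝ (Fin 3)) →L[ℝ] (EuclideanSpace ℝ (Fin 3)) →L[ℝ] ℝ`
set_option maxSynthPendingDepth 3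

variable {ν a : ℝ} {U : (EuclideanSpace ℝ (Fin 3)) → (EuclideanSpace ℝ (Fin 3))} {P : (EuclideanSpace ℝ (Fin 3)) → ℝ} {ρ : ℝ} {x₀ : (EuclideanSpace ℝ (Fin 3))}

/-! ### The localised field and its normalised pressure -/

/-- The translated cutoff `θ_{x₀,ρ}` equals `1` on `B̄(x₀, 4ρ)`. [folklore] -/
theorem cutoff_sub_eq_one (hρ : 0 < ρ) {x : (EuclideanSpace ℝ (Fin 3))} (hx : x ∈ closedBall x₀ (4 * ρ)) :
    cutoff (4 * ρ) (x - x₀) = 1 :=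
  cutoff_eq_one (by positivity) (by rwa [mem_closedBall, dist_eq_norm] at hx)

/-- The translated cutoff `θ_{x₀,ρ}` vanishes off `B(x₀, 8ρ)`. [folklore] -/
theorem cutoff_sub_eq_zero (hρ : 0 < ρ) {x : (EuclideanSpace ℝ (Fin 3))} (hx : x ∉ ball x₀ (8 * ρ)) :
    cutoff (4 * ρ) (x - x₀) = 0 :=
  cutoff_eq_zero (by positivity) (by rw [mem_ball, dist_eq_norm, not_lt] at hx; linarith)

/-- The localised field is smooth. [folklore] -/
theorem contDiff_locF (hU : ContDiff ℝ ∞ U) : ContDiff ℝ ∞ (fun w : EuclideanSpace ℝ (Fin 3) => cutoff (4 * ρ) (w - x₀) • U w) := by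
  have h1 : ContDiff ℝ ∞ (fun x : (EuclideanSpace ℝ (Fin 3)) => cutoff (4 * ρ) (x - x₀)) :=
    (contDiff_cutoff (n := ⊤) (4 * ρ)).comp (contDiff_id.sub contDiff_const)
  exact h1.smul hU

/-- The localised field vanishes off `B(x₀, 8ρ)`. [folklore] -/
theorem locF_eq_zero (hρ : 0 < ρ) {x : (EuclideanSpace ℝ (Fin 3))} (hx : x ∉ ball x₀ (8 * ρ)) : (fun w : EuclideanSpace ℝ (Fin 3) => cutoff (4 * ρ) (w - x₀) • U w) x = 0 := by
  show cutoff (4 * ρ) (x - x₀) • U x = 0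
  rw [cutoff_sub_eq_zero hρ hx, zero_smul]

/-- The localised field agrees with `U` on `B̄(x₀, 4ρ)`. [folklore] -/
theorem locF_eq_self (hρ : 0 < ρ) {x : (EuclideanSpace ℝ (Fin 3))} (hx : x ∈ closedBall x₀ (4 * ρ)) : (fun w : EuclideanSpace ℝ (Fin 3) => cutoff (4 * ρ) (w - x₀) • U w) x = U x := by
  show cutoff (4 * ρ) (x - x₀) • U x = U x
  rw [cutoff_sub_eq_one hρ hx, one_smul]

/-- The localised field has compact support (in `B̄(x₀, 8ρ)`). [folklore] -/
theorem hasCompactSupport_locF (hρ : 0 < ρ) : HasCompactSupport (fun w : EuclideanSpace ℝ (Fin 3) => cutoff (4 * ρ) (w - x₀) • U w) :=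
  HasCompactSupport.intro (isCompact_closedBall x₀ (8 * ρ)) fun _ hx =>
    locF_eq_zero hρ fun h => hx (ball_subset_closedBall h)

/-- `|θU| ≤ |U|` pointwise. [folklore] -/
theorem norm_locF_le (x : (EuclideanSpace ℝ (Fin 3))) : ‖(fun w : EuclideanSpace ℝ (Fin 3) => cutoff (4 * ρ) (w - x₀) • U w) x‖ ≤ ‖U x‖ := by
  show ‖cutoff (4 * ρ) (x - x₀) • U x‖ ≤ ‖U x‖
  rw [norm_smul, Real.norm_eq_abs]
  exact mul_le_of_le_one_left (norm_nonneg _) (abs_cutoff_le_one _ _)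

/-- `|θU|²` is integrable (continuous with compact support). [folklore] -/
theorem integrable_norm_locF_sq (hU : ContDiff ℝ ∞ U) (hρ : 0 < ρ) :
    Integrable fun x => ‖(fun w : EuclideanSpace ℝ (Fin 3) => cutoff (4 * ρ) (w - x₀) • U w) x‖ ^ 2 := by
  have h1 : Continuous fun x => ‖(fun w : EuclideanSpace ℝ (Fin 3) => cutoff (4 * ρ) (w - x₀) • U w) x‖ ^ 2 := (contDiff_locF hU).continuous.norm.pow 2
  refine h1.integrable_of_hasCompactSupport ?_
  refine HasCompactSupport.intro (isCompact_closedBall x₀ (8 * ρ)) fun x hx => ?_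
  show ‖(fun w : EuclideanSpace ℝ (Fin 3) => cutoff (4 * ρ) (w - x₀) • U w) x‖ ^ 2 = 0
  rw [locF_eq_zero hρ fun h => hx (ball_subset_closedBall h), norm_zero, zero_pow two_ne_zero]

/-- The normalised pressure of the localised field is its pressure potential `Q[θU]`. [folklore] -/
theorem normalisedPressure_locF_eq (hU : ContDiff ℝ ∞ U) (hρ : 0 < ρ) :
    normalisedPressure (fun w : EuclideanSpace ℝ (Fin 3) => cutoff (4 * ρ) (w - x₀) • U w) = pressurePotential (fun w : EuclideanSpace ℝ (Fin 3) => cutoff (4 * ρ) (w - x₀) • U w) :=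
  normalisedPressure_eq_pressurePotential' ((contDiff_locF hU).of_le (by norm_cast))
    (integrable_norm_locF_sq hU hρ)

/-- The normalised pressure of the localised field is `C²`. [folklore] -/
theorem contDiff_normalisedPressure_locF (hU : ContDiff ℝ ∞ U) (hρ : 0 < ρ) :
    ContDiff ℝ 2 (normalisedPressure (fun w : EuclideanSpace ℝ (Fin 3) => cutoff (4 * ρ) (w - x₀) • U w)) := by
  rw [normalisedPressure_locF_eq hU hρ]
  exact contDiff_pressurePotential ((contDiff_locF hU).of_le (by norm_cast))
    (integrable_norm_locF_sq hU hρ)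

/-- `Δ p̃[θU] = −G[θU]` pointwise (`G[v] = ∂ᵢ∂ⱼ(vᵢvⱼ)`). [cite: GilbargTrudinger2001, Lemma 4.2] -/
theorem laplacian_normalisedPressure_locF (hU : ContDiff ℝ ∞ U) (hρ : 0 < ρ) (x : (EuclideanSpace ℝ (Fin 3))) :
    (Δ (normalisedPressure (fun w : EuclideanSpace ℝ (Fin 3) => cutoff (4 * ρ) (w - x₀) • U w))) x = -pressureSource (fun w : EuclideanSpace ℝ (Fin 3) => cutoff (4 * ρ) (w - x₀) • U w) x := by
  rw [normalisedPressure_locF_eq hU hρ]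
  exact laplacian_pressurePotential ((contDiff_locF hU).of_le (by norm_cast))
    (integrable_norm_locF_sq hU hρ) x

/-! ### Locality of the quadratic source and harmonicity of `P − p̃[θU]` -/

/-- The divergence only depends on the germ of the field. [folklore] -/
theorem divergence_congr_of_eventuallyEq {E : Type*} [NormedAddCommGroup E]
    [InnerProductSpace ℝ E] [FiniteDimensional ℝ E] {v w : E → E} {x : E} (h : v =ᶠ[𝓝 x] w) :
    VectorCalculus.divergence v x = VectorCalculus.divergence w x := by
  simp only [VectorCalculus.divergence, h.fderiv_eq]

/-- The quadratic source `G[v] = div((v·∇)v + (div v) v)` only depends on the germ of `v`.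
[folklore] -/
theorem pressureSource_congr_of_eventuallyEq {E : Type*} [NormedAddCommGroup E]
    [InnerProductSpace ℝ E] [FiniteDimensional ℝ E] {v w : E → E} {x : E} (h : v =ᶠ[𝓝 x] w) :
    pressureSource v x = pressureSource w x := by
  refine divergence_congr_of_eventuallyEq ?_
  have hD : fderiv ℝ v =ᶠ[𝓝 x] fderiv ℝ w := h.fderiv
  have hdiv : VectorCalculus.divergence v =ᶠ[𝓝 x] VectorCalculus.divergence w := by
    filter_upwards [hD] with y hy
    simp only [VectorCalculus.divergence, hy]
  filter_upwards [h, hD, hdiv] with y hy hDy hdivy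
  simp only [convect, hy, hDy, hdivy]

/-- **`P − p̃[θ_{x₀}U]` is harmonic on `B(x₀, 4ρ)`**: there `θ = 1`, so
`Δp̃[θU] = −∂ᵢ∂ⱼ(UᵢUⱼ) = −tr (DU∘DU) = ΔP` by the pressure Poisson equation of the profile.
[cite: Tsai1998, (2.1) (p. 34)] -/
theorem IsLerayProfile.laplacian_pressure_sub_localPressure_eq_zero (hprof : IsLerayProfile ν a U P)
    (hU : ContDiff ℝ ∞ U) (hρ : 0 < ρ) {x : (EuclideanSpace ℝ (Fin 3))} (hx : x ∈ ball x₀ (4 * ρ)) :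
    (Δ (fun y => P y - normalisedPressure (fun w : EuclideanSpace ℝ (Fin 3) => cutoff (4 * ρ) (w - x₀) • U w) y)) x = 0 := by
  have hU3 : ContDiff ℝ 3 U := hU.of_le (by norm_cast)
  have hU2 : ContDiff ℝ 2 U := hU.of_le (by norm_cast)
  have hP2 : ContDiff ℝ 2 P := hprof.contDiff_two_pressure hU3
  have hN2 := contDiff_normalisedPressure_locF hU hρ (x₀ := x₀)
  have hfun : (fun y => P y - normalisedPressure (fun w : EuclideanSpace ℝ (Fin 3) => cutoff (4 * ρ) (w - x₀) • U w) y) = P - normalisedPressure (fun w : EuclideanSpace ℝ (Fin 3) => cutoff (4 * ρ) (w - x₀) • U w) := rfl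
  rw [hfun, hP2.contDiffAt.laplacian_sub hN2.contDiffAt,
    laplacian_normalisedPressure_locF hU hρ x, sub_neg_eq_add,
    hprof.laplacian_pressure_eq hU3 hP2 x]
  -- `G[θU](x) = G[U](x) = div((U·∇)U)(x) = tr (DU∘DU)`
  have hgerm : (fun w : EuclideanSpace ℝ (Fin 3) => cutoff (4 * ρ) (w - x₀) • U w) =ᶠ[𝓝 x] U := by
    filter_upwards [isOpen_ball.mem_nhds hx] with y hy
    exact locF_eq_self hρ (ball_subset_closedBall hy)
  rw [pressureSource_congr_of_eventuallyEq hgerm, pressureSource_eq_of_isDivFree hprof.divFree,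
    divergence_convect_self_eq hU2 hprof.divFree x]
  ring

/-! ### The reflected weight `Ψ_y = λ(y − ·)` -/

/-- Bounds for the weight `λ^{ρ,2ρ}` and its first and second derivatives. [folklore] -/
theorem exists_bounds_newtonFarLaplacian (hρ : 0 < ρ) :
    ∃ M₀ M₁ M₂ : ℝ, 0 ≤ M₀ ∧ 0 ≤ M₁ ∧ 0 ≤ M₂ ∧
      (∀ z : (EuclideanSpace ℝ (Fin 3)), |newtonFarLaplacian ρ (2 * ρ) z| ≤ M₀) ∧
      (∀ z : (EuclideanSpace ℝ (Fin 3)), ‖fderiv ℝ (newtonFarLaplacian ρ (2 * ρ)) z‖ ≤ M₁) ∧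
      (∀ z : (EuclideanSpace ℝ (Fin 3)), |(Δ (newtonFarLaplacian ρ (2 * ρ))) z| ≤ M₂) := by
  have h₁ : ρ < 2 * ρ := by linarith
  set lam := newtonFarLaplacian ρ (2 * ρ) with hlam
  have hs : ContDiff ℝ ∞ lam := contDiff_newtonFarLaplacian hρ h₁
  have hc : HasCompactSupport lam := hasCompactSupport_newtonFarLaplacian hρ.le h₁
  obtain ⟨M₀, hM₀⟩ := hs.continuous.bounded_above_of_compact_support hc
  obtain ⟨M₁, -, hM₁⟩ := exists_bound_fderiv_newtonFarLaplacian hρ h₁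
  obtain ⟨M₂, hM₂⟩ := (FluidPDE.continuous_laplacian (hs.of_le (by norm_cast))).bounded_above_of_compact_support
    (hc.mono' fun z hz => by
      contrapose! hz
      simp only [mem_support, not_not]
      exact laplacian_eq_zero_of_notMem_tsupport hz)
  refine ⟨max M₀ 0, M₁, max M₂ 0, le_max_right _ _, (norm_nonneg _).trans (hM₁ 0), le_max_right _ _,
    fun z => ?_, hM₁, fun z => ?_⟩
  · rw [← Real.norm_eq_abs]; exact (hM₀ z).trans (le_max_left _ _)
  · rw [← Real.norm_eq_abs]; exact (hM₂ z).trans (le_max_left _ _)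

/-- The gradient of the pressure of a Leray profile: `∇P = νΔU − aU − a(y·∇)U − (U·∇)U`.
[cite: Tsai1998, (1.3)] -/
theorem IsLerayProfile.gradient_pressure_eq (hprof : IsLerayProfile ν a U P) (y : (EuclideanSpace ℝ (Fin 3))) :
    gradient P y = ν • (Δ U) y - a • U y - a • fderiv ℝ U y y - convect U U y := by
  have hy := hprof.profile_eq y
  rw [← sub_eq_zero, ← hy]
  abel

/-- **The weighted average of `∂ₐP` is controlled by `L¹`/`L²` norms of `U`**: for the pressure
of a Leray profile with `U ∈ C^∞`, a weight `Ψ ∈ C^∞_c` supported in `S ⊆ B̄(0, R)` with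
`|Ψ| ≤ M₀`, `‖DΨ‖ ≤ M₁`, `|ΔΨ| ≤ M₂`,
`|∫ Ψ ∂ₐP| ≤ ‖a‖ [(ν M₂ + a M₀ + a (M₁ R + 3 M₀)) ∫_S |U| + M₁ ∫_S |U|²]`.
[cite: Tsai1998, proof of Lemma 2.1 (pp. 35–36)] -/
theorem IsLerayProfile.abs_integral_weight_mul_fderiv_pressure_le (hprof : IsLerayProfile ν a U P)
    (hU : ContDiff ℝ ∞ U) (hν : 0 ≤ ν) (ha : 0 ≤ a) {Ψ : (EuclideanSpace ℝ (Fin 3)) → ℝ} (hΨ : ContDiff ℝ 2 Ψ)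
    (hΨc : HasCompactSupport Ψ) {S : Set (EuclideanSpace ℝ (Fin 3))} (hS : MeasurableSet S) (hScpt : IsCompact S)
    (hΨS : tsupport Ψ ⊆ S) {M₀ M₁ M₂ R : ℝ} (hM₀ : 0 ≤ M₀) (hM₁ : 0 ≤ M₁) (hM₂ : 0 ≤ M₂)
    (hR : 0 ≤ R) (hΨ0 : ∀ w, |Ψ w| ≤ M₀) (hΨ1 : ∀ w, ‖fderiv ℝ Ψ w‖ ≤ M₁)
    (hΨ2 : ∀ w, |(Δ Ψ) w| ≤ M₂) (hSR : ∀ w ∈ S, ‖w‖ ≤ R) (e : (EuclideanSpace ℝ (Fin 3))) :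
    |∫ w, Ψ w * fderiv ℝ P w e| ≤
      ‖e‖ * ((ν * M₂ + a * M₀ + a * (M₁ * R + 3 * M₀)) * (∫ w in S, ‖U w‖) +
        M₁ * ∫ w in S, ‖U w‖ ^ 2) := by
  have hU2 : ContDiff ℝ 2 U := hU.of_le (by norm_cast)
  have hU1 : ContDiff ℝ 1 U := hU.of_le (by norm_cast)
  have hΨ1' : ContDiff ℝ 1 Ψ := hΨ.of_le one_le_two
  have hUc : Continuous U := hU.continuous
  have hIU : IntegrableOn (fun w => ‖U w‖) S := hUc.norm.continuousOn.integrableOn_compact hScpt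
  have hIU2 : IntegrableOn (fun w => ‖U w‖ ^ 2) S :=
    (hUc.norm.pow 2).continuousOn.integrableOn_compact hScpt
  -- `∂ₑP = ⟪∇P, e⟫ = ν ⟪ΔU, e⟫ − a ⟪U, e⟫ − a ⟪DU w w, e⟫ − ⟪(U·∇)U, e⟫`
  have hpt : ∀ w, Ψ w * fderiv ℝ P w e = ν * (Ψ w * ⟪(Δ U) w, e⟫) - a * (Ψ w * ⟪U w, e⟫)
      - a * (Ψ w * ⟪fderiv ℝ U w w, e⟫) - Ψ w * ⟪convect U U w, e⟫ := fun w => by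
    rw [← inner_gradient_left, hprof.gradient_pressure_eq w]
    simp only [inner_sub_left, inner_smul_left, RCLike.conj_to_real]
    ring
  -- integrability of the four pieces (continuous integrands, `Ψ` compactly supported)
  have hint : ∀ {G : (EuclideanSpace ℝ (Fin 3)) → ℝ}, Continuous G → Integrable fun w => Ψ w * G w := fun hG =>
    (hΨ.continuous.mul hG).integrable_of_hasCompactSupport hΨc.mul_right
  have hc1 : Continuous fun w => ⟪(Δ U) w, e⟫ := (FluidPDE.continuous_laplacian hU2).inner continuous_const
  have hc2 : Continuous fun w => ⟪U w, e⟫ := hUc.inner continuous_const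
  have hc3 : Continuous fun w => ⟪fderiv ℝ U w w, e⟫ :=
    ((hU1.continuous_fderiv one_ne_zero).clm_apply continuous_id).inner continuous_const
  have hc4 : Continuous fun w => ⟪convect U U w, e⟫ :=
    ((hU1.continuous_fderiv one_ne_zero).clm_apply hUc).inner continuous_const
  have hsplit : ∫ w, Ψ w * fderiv ℝ P w e = ν * (∫ w, Ψ w * ⟪(Δ U) w, e⟫) - a * (∫ w, Ψ w * ⟪U w, e⟫)
      - a * (∫ w, Ψ w * ⟪fderiv ℝ U w w, e⟫) - ∫ w, Ψ w * ⟪convect U U w, e⟫ := by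
    simp_rw [hpt]
    rw [integral_sub, integral_sub, integral_sub, integral_const_mul, integral_const_mul,
      integral_const_mul]
    · exact (hint hc1).const_mul ν
    · exact (hint hc2).const_mul a
    · exact ((hint hc1).const_mul ν).sub ((hint hc2).const_mul a)
    · exact (hint hc3).const_mul a
    · exact (((hint hc1).const_mul ν).sub ((hint hc2).const_mul a)).sub ((hint hc3).const_mul a)
    · exact hint hc4
  -- the four weighted bounds
  have b1 := abs_integral_weight_mul_inner_laplacian_le hS hΨ hΨc hΨS hM₂ hΨ2 hU2 hIU e
  have b2 := abs_integral_weight_mul_inner_le hS hΨS hM₀ hΨ0 hIU e (U := U)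
  have b3 := abs_integral_weight_mul_inner_fderiv_apply_self_le hS hΨ1' hΨc hΨS hM₀ hM₁ hR hΨ0
    hΨ1 hSR hU1 hIU e
  have b4 := abs_integral_weight_mul_inner_convect_le hS hΨ1' hΨc hΨS hM₁ hΨ1 hU1 hprof.divFree
    hIU2 e
  rw [finrank_euclideanSpace_fin] at b3
  push_cast at b3
  have hI1 : 0 ≤ ∫ w in S, ‖U w‖ := integral_nonneg fun w => norm_nonneg _
  have hI2 : 0 ≤ ∫ w in S, ‖U w‖ ^ 2 := integral_nonneg fun w => by positivity
  rw [hsplit]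
  set I₁ := ∫ w, Ψ w * ⟪(Δ U) w, e⟫ with hI₁d
  set I₂ := ∫ w, Ψ w * ⟪U w, e⟫ with hI₂d
  set I₃ := ∫ w, Ψ w * ⟪fderiv ℝ U w w, e⟫ with hI₃d
  set I₄ := ∫ w, Ψ w * ⟪convect U U w, e⟫ with hI₄d
  set J₁ := ∫ w in S, ‖U w‖ with hJ₁d
  set J₂ := ∫ w in S, ‖U w‖ ^ 2 with hJ₂d
  have htri : |ν * I₁ - a * I₂ - a * I₃ - I₄| ≤ ν * |I₁| + a * |I₂| + a * |I₃| + |I₄| := by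
    have h1 := abs_sub (ν * I₁ - a * I₂ - a * I₃) I₄
    have h2 := abs_sub (ν * I₁ - a * I₂) (a * I₃)
    have h3 := abs_sub (ν * I₁) (a * I₂)
    rw [abs_mul, abs_mul, abs_of_nonneg hν, abs_of_nonneg ha] at h3
    rw [abs_mul, abs_of_nonneg ha] at h2
    linarith
  calc |ν * I₁ - a * I₂ - a * I₃ - I₄| ≤ ν * |I₁| + a * |I₂| + a * |I₃| + |I₄| := htri
    _ ≤ ν * (‖e‖ * M₂ * J₁) + a * (‖e‖ * M₀ * J₁) + a * (‖e‖ * (M₁ * R + 3 * M₀) * J₁)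
        + ‖e‖ * M₁ * J₂ := by gcongr
    _ = ‖e‖ * ((ν * M₂ + a * M₀ + a * (M₁ * R + 3 * M₀)) * J₁ + M₁ * J₂) := by ring

/-- The reflected weight `Ψ_y(w) = λ^{ρ,2ρ}(y − w)`: `C²`, compactly supported in `B̄(y, 2ρ)`, with
the same bounds as `λ` on itself, its derivative and its Laplacian. [folklore] -/
theorem reflectedWeight_props (hρ : 0 < ρ) (y : (EuclideanSpace ℝ (Fin 3))) {M₀ M₁ M₂ : ℝ}
    (hl0 : ∀ z : (EuclideanSpace ℝ (Fin 3)), |newtonFarLaplacian ρ (2 * ρ) z| ≤ M₀)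
    (hl1 : ∀ z : (EuclideanSpace ℝ (Fin 3)), ‖fderiv ℝ (newtonFarLaplacian ρ (2 * ρ)) z‖ ≤ M₁)
    (hl2 : ∀ z : (EuclideanSpace ℝ (Fin 3)), |(Δ (newtonFarLaplacian ρ (2 * ρ))) z| ≤ M₂) :
    ContDiff ℝ 2 (fun w => newtonFarLaplacian ρ (2 * ρ) (y - w)) ∧
    HasCompactSupport (fun w => newtonFarLaplacian ρ (2 * ρ) (y - w)) ∧
    tsupport (fun w => newtonFarLaplacian ρ (2 * ρ) (y - w)) ⊆ closedBall y (2 * ρ) ∧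
    (∀ w, |newtonFarLaplacian ρ (2 * ρ) (y - w)| ≤ M₀) ∧
    (∀ w, ‖fderiv ℝ (fun w => newtonFarLaplacian ρ (2 * ρ) (y - w)) w‖ ≤ M₁) ∧
    (∀ w, |(Δ (fun w => newtonFarLaplacian ρ (2 * ρ) (y - w))) w| ≤ M₂) := by
  have h₁ : ρ < 2 * ρ := by linarith
  set lam := newtonFarLaplacian ρ (2 * ρ) with hlam
  have hs : ContDiff ℝ 2 lam := contDiff_newtonFarLaplacian hρ h₁
  have hsupp : tsupport (fun w => lam (y - w)) ⊆ closedBall y (2 * ρ) := by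
    refine closure_minimal (fun w hw => ?_) isClosed_closedBall
    rw [mem_closedBall, dist_comm, dist_eq_norm]
    by_contra hgt
    exact hw (newtonFarLaplacian_eq_zero_of_gt hρ.le h₁ (not_le.1 hgt))
  refine ⟨hs.comp (contDiff_const.sub contDiff_id), ?_, hsupp, fun w => hl0 _, fun w => ?_,
    fun w => ?_⟩
  · exact (isCompact_closedBall y (2 * ρ)).of_isClosed_subset isClosed_closure hsupp
  · rw [fderiv_comp_const_sub, norm_neg]; exact hl1 _
  · rw [laplacian_comp_const_sub]; exact hl2 _

/-- **Interior gradient bound for the harmonic part of the pressure.** For a Leray profile with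
`U ∈ C^∞`, `ν, a ≥ 0`, a centre `x₀`, the localised normalised pressure `N = p̃[θ_{x₀,ρ}U]` and
`y ∈ B̄(x₀, ρ)`: if `λ = λ^{ρ,2ρ}` satisfies `|λ| ≤ M₀`, `‖Dλ‖ ≤ M₁`, `|Δλ| ≤ M₂`, and
`∫_{B̄(y,2ρ)} |U| ≤ A₁`, `∫_{B̄(y,2ρ)} |U|² ≤ A₂`, `∫_{B̄(y,2ρ)} |N| ≤ A₃`, then
`‖D(P − N)(y)‖ ≤ (ν M₂ + a M₀ + a (M₁ (|x₀| + 3ρ) + 3 M₀)) A₁ + M₁ A₂ + M₁ A₃`.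
(Gradient formula on the ball `B(y, 3ρ) ⊆ B(x₀, 4ρ)` where `P − N` is harmonic; `∇P` by Leray's
system with all derivatives moved onto the weight; `N` in `L¹`.)
[cite: Tsai1998, Lemma 2.1 and Remark 3.1] -/
theorem IsLerayProfile.norm_fderiv_pressure_sub_localPressure_le (hprof : IsLerayProfile ν a U P)
    (hU : ContDiff ℝ ∞ U) (hν : 0 ≤ ν) (ha : 0 ≤ a) (hρ : 0 < ρ) {M₀ M₁ M₂ : ℝ} (hM₀ : 0 ≤ M₀)
    (hM₁ : 0 ≤ M₁) (hM₂ : 0 ≤ M₂) (hl0 : ∀ z : (EuclideanSpace ℝ (Fin 3)), |newtonFarLaplacian ρ (2 * ρ) z| ≤ M₀)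
    (hl1 : ∀ z : (EuclideanSpace ℝ (Fin 3)), ‖fderiv ℝ (newtonFarLaplacian ρ (2 * ρ)) z‖ ≤ M₁)
    (hl2 : ∀ z : (EuclideanSpace ℝ (Fin 3)), |(Δ (newtonFarLaplacian ρ (2 * ρ))) z| ≤ M₂) {y : (EuclideanSpace ℝ (Fin 3))}
    (hy : y ∈ closedBall x₀ ρ) {A₁ A₂ A₃ : ℝ} (hA₁ : ∫ w in closedBall y (2 * ρ), ‖U w‖ ≤ A₁)
    (hA₂ : ∫ w in closedBall y (2 * ρ), ‖U w‖ ^ 2 ≤ A₂)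
    (hA₃ : ∫ w in closedBall y (2 * ρ), |normalisedPressure (fun w : EuclideanSpace ℝ (Fin 3) => cutoff (4 * ρ) (w - x₀) • U w) w| ≤ A₃) :
    ‖fderiv ℝ (fun x => P x - normalisedPressure (fun w : EuclideanSpace ℝ (Fin 3) => cutoff (4 * ρ) (w - x₀) • U w) x) y‖ ≤
      (ν * M₂ + a * M₀ + a * (M₁ * (‖x₀‖ + 3 * ρ) + 3 * M₀)) * A₁ + M₁ * A₂ + M₁ * A₃ := by
  have h₁ : ρ < 2 * ρ := by linarith
  have h₂ : 2 * ρ < 3 * ρ := by linarith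
  set lam := newtonFarLaplacian ρ (2 * ρ) with hlam
  have hls : ContDiff ℝ 1 lam := contDiff_newtonFarLaplacian hρ h₁
  have hlc : HasCompactSupport lam := hasCompactSupport_newtonFarLaplacian hρ.le h₁
  set N := normalisedPressure (fun w : EuclideanSpace ℝ (Fin 3) => cutoff (4 * ρ) (w - x₀) • U w) with hN
  have hU3 : ContDiff ℝ 3 U := hU.of_le (by norm_cast)
  have hP2 : ContDiff ℝ 2 P := hprof.contDiff_two_pressure hU3
  have hP1 : ContDiff ℝ 1 P := hP2.of_le one_le_two
  have hN2 : ContDiff ℝ 2 N := contDiff_normalisedPressure_locF hU hρ (x₀ := x₀)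
  set h : (EuclideanSpace ℝ (Fin 3)) → ℝ := fun x => P x - N x with hh
  have hh2 : ContDiff ℝ 2 h := hP2.sub hN2
  -- harmonic on `B(y, 3ρ) ⊆ B(x₀, 4ρ)`
  have hΔ : ∀ w ∈ ball y (3 * ρ), (Δ h) w = 0 := by
    intro w hw
    refine hprof.laplacian_pressure_sub_localPressure_eq_zero hU hρ ?_
    rw [mem_ball] at hw ⊢
    rw [mem_closedBall] at hy
    calc dist w x₀ ≤ dist w y + dist y x₀ := dist_triangle _ _ _
      _ < 3 * ρ + ρ := add_lt_add_of_lt_of_le hw hy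
      _ = 4 * ρ := by ring
  -- the reflected weight
  obtain ⟨hΨ2, hΨc, hΨS, hΨ0, hΨ1, hΨ2'⟩ := reflectedWeight_props hρ y hl0 hl1 hl2
  have hSR : ∀ w ∈ closedBall y (2 * ρ), ‖w‖ ≤ ‖x₀‖ + 3 * ρ := fun w hw => by
    rw [mem_closedBall, dist_eq_norm] at hw hy
    calc ‖w‖ = ‖(w - y) + (y - x₀) + x₀‖ := by abel_nf
      _ ≤ ‖w - y‖ + ‖y - x₀‖ + ‖x₀‖ := norm_add₃_le
      _ ≤ 2 * ρ + ρ + ‖x₀‖ := by gcongr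
      _ = ‖x₀‖ + 3 * ρ := by ring
  have hR : 0 ≤ ‖x₀‖ + 3 * ρ := by positivity
  -- the bound in each direction `e`
  have key : ∀ e : (EuclideanSpace ℝ (Fin 3)), ‖fderiv ℝ h y e‖ ≤
      ((ν * M₂ + a * M₀ + a * (M₁ * (‖x₀‖ + 3 * ρ) + 3 * M₀)) * A₁ + M₁ * A₂ + M₁ * A₃) * ‖e‖ := by
    intro e
    rw [Real.norm_eq_abs,
      fderiv_apply_eq_integral_fderiv_newtonFarLaplacian_mul hρ h₁ hh2 h₂ hΔ e]
    -- split `h = P − N`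
    have hiP : Integrable fun z => fderiv ℝ lam z e * P (y - z) :=
      (((hls.continuous_fderiv one_ne_zero).clm_apply continuous_const).mul
        (hP1.continuous.comp (continuous_const.sub continuous_id))).integrable_of_hasCompactSupport
        (hlc.fderiv_apply (𝕜 := ℝ) e).mul_right
    have hiN : Integrable fun z => fderiv ℝ lam z e * N (y - z) :=
      (((hls.continuous_fderiv one_ne_zero).clm_apply continuous_const).mul
        (hN2.continuous.comp (continuous_const.sub continuous_id))).integrable_of_hasCompactSupport
        (hlc.fderiv_apply (𝕜 := ℝ) e).mul_right
    have hsplit : ∫ z, fderiv ℝ lam z e * h (y - z) =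
        (∫ z, fderiv ℝ lam z e * P (y - z)) - ∫ z, fderiv ℝ lam z e * N (y - z) := by
      rw [← integral_sub hiP hiN]
      refine integral_congr_ae (Eventually.of_forall fun z => ?_)
      simp only [hh]
      ring
    -- the `P` part: derivative onto `P`, then the weighted bound
    have hPpart : |∫ z, fderiv ℝ lam z e * P (y - z)| ≤
        ‖e‖ * ((ν * M₂ + a * M₀ + a * (M₁ * (‖x₀‖ + 3 * ρ) + 3 * M₀)) * A₁ + M₁ * A₂) := by
      rw [integral_fderiv_mul_comp_sub hls hlc hP1 y e]
      have hcv : ∫ z, lam z * fderiv ℝ P (y - z) e = ∫ w, lam (y - w) * fderiv ℝ P w e := by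
        rw [← integral_sub_left_eq_self (fun z => lam z * fderiv ℝ P (y - z) e) volume y]
        refine integral_congr_ae (Eventually.of_forall fun w => ?_)
        simp only [sub_sub_cancel]
      rw [hcv]
      have hb := hprof.abs_integral_weight_mul_fderiv_pressure_le hU hν ha hΨ2 hΨc
        measurableSet_closedBall (isCompact_closedBall y (2 * ρ)) hΨS hM₀ hM₁ hM₂ hR hΨ0 hΨ1 hΨ2'
        hSR e
      refine hb.trans ?_
      have hJ1 : 0 ≤ ∫ w in closedBall y (2 * ρ), ‖U w‖ := integral_nonneg fun w => norm_nonneg _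
      have hJ2 : 0 ≤ ∫ w in closedBall y (2 * ρ), ‖U w‖ ^ 2 := integral_nonneg fun w => by positivity
      have hcoef : 0 ≤ ν * M₂ + a * M₀ + a * (M₁ * (‖x₀‖ + 3 * ρ) + 3 * M₀) := by positivity
      gcongr
    -- the `N` part
    have hNpart : |∫ z, fderiv ℝ lam z e * N (y - z)| ≤ ‖e‖ * (M₁ * A₃) := by
      have hcv : ∫ z, fderiv ℝ lam z e * N (y - z) = ∫ w, fderiv ℝ lam (y - w) e * N w := by
        rw [← integral_sub_left_eq_self (fun z => fderiv ℝ lam z e * N (y - z)) volume y]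
        refine integral_congr_ae (Eventually.of_forall fun w => ?_)
        simp only [sub_sub_cancel]
      rw [hcv]
      have hIN : IntegrableOn (fun w => |N w|) (closedBall y (2 * ρ)) :=
        hN2.continuous.abs.continuousOn.integrableOn_compact (isCompact_closedBall _ _)
      have hb := abs_integral_le_of_support_subset (f := fun w => fderiv ℝ lam (y - w) e * N w)
        (g := fun w => |N w|) (C := ‖e‖ * M₁) measurableSet_closedBall (fun w hw => ?_)
        (fun w _ => ?_) hIN
      · refine hb.trans ?_
        rw [mul_assoc]
        gcongr
      · have hw' : 2 * ρ < ‖y - w‖ := by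
          rw [mem_closedBall, dist_comm, dist_eq_norm, not_le] at hw
          exact hw
        have : fderiv ℝ lam (y - w) = 0 := by
          refine fderiv_of_notMem_tsupport ℝ fun hmem => ?_
          have := tsupport_newtonFarLaplacian_subset hρ.le h₁ hmem
          rw [mem_closedBall_zero_iff] at this
          linarith
        show fderiv ℝ lam (y - w) e * N w = 0
        rw [this, _root_.zero_apply, zero_mul]
      · show |fderiv ℝ lam (y - w) e * N w| ≤ ‖e‖ * M₁ * |N w|
        rw [abs_mul]
        gcongr
        rw [← Real.norm_eq_abs]
        calc ‖fderiv ℝ lam (y - w) e‖ ≤ ‖fderiv ℝ lam (y - w)‖ * ‖e‖ := ContinuousLinearMap.le_opNorm _ _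
          _ ≤ M₁ * ‖e‖ := by gcongr; exact hl1 _
          _ = ‖e‖ * M₁ := mul_comm _ _
    rw [hsplit]
    calc |(∫ z, fderiv ℝ lam z e * P (y - z)) - ∫ z, fderiv ℝ lam z e * N (y - z)|
        ≤ |∫ z, fderiv ℝ lam z e * P (y - z)| + |∫ z, fderiv ℝ lam z e * N (y - z)| := abs_sub _ _
      _ ≤ ‖e‖ * ((ν * M₂ + a * M₀ + a * (M₁ * (‖x₀‖ + 3 * ρ) + 3 * M₀)) * A₁ + M₁ * A₂) +
          ‖e‖ * (M₁ * A₃) := add_le_add hPpart hNpart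
      _ = ((ν * M₂ + a * M₀ + a * (M₁ * (‖x₀‖ + 3 * ρ) + 3 * M₀)) * A₁ + M₁ * A₂ + M₁ * A₃) * ‖e‖ := by
          ring
  have hK : 0 ≤ (ν * M₂ + a * M₀ + a * (M₁ * (‖x₀‖ + 3 * ρ) + 3 * M₀)) * A₁ + M₁ * A₂ + M₁ * A₃ := by
    have h0 := key 0
    -- evaluate the bound with a unit-free argument: use any `e` with `‖e‖ = 1`
    obtain ⟨e, he⟩ : ∃ e : (EuclideanSpace ℝ (Fin 3)), ‖e‖ = 1 := exists_norm_eq (EuclideanSpace ℝ (Fin 3)) zero_le_one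
    have h1 := key e
    rw [he, mul_one] at h1
    exact (norm_nonneg _).trans h1
  exact ContinuousLinearMap.opNorm_le_bound _ hK key

/-! ### From global `L^q` bounds to local `L¹` bounds, uniformly in the centre -/

/-- **Local `L¹` norms from a global `L^q` bound, uniformly in the centre**: if
`‖F‖_{L^q((EuclideanSpace ℝ (Fin 3)))} ≤ B`, `1 ≤ q ≤ ∞`, then `∫_{B̄(y, r)} |F| ≤ C_{r,q} B` for every centre `y`, with
`C_{r,q} = |B̄(0, r)|^{1 − 1/q}` (Hölder on the ball; `1/∞ = 0`). [folklore] -/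
theorem setIntegral_norm_le_of_eLpNorm_le {G : Type*} [NormedAddCommGroup G] {F : (EuclideanSpace ℝ (Fin 3)) → G}
    (hF : AEStronglyMeasurable F volume) {q : ℝ≥0∞} (hq : 1 ≤ q) {B : ℝ} (hB : 0 ≤ B)
    (hFq : eLpNorm F q volume ≤ ENNReal.ofReal B) (y : (EuclideanSpace ℝ (Fin 3))) (r : ℝ) :
    IntegrableOn F (closedBall y r) ∧
    ∫ w in closedBall y r, ‖F w‖ ≤
      ((volume (closedBall (0 : (EuclideanSpace ℝ (Fin 3))) r)) ^ (1 - 1 / q.toReal)).toReal * B := by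
  set μ := (volume : Measure (EuclideanSpace ℝ (Fin 3))).restrict (closedBall y r) with hμ
  have hFμ : AEStronglyMeasurable F μ := hF.restrict
  have hvol : μ Set.univ = volume (closedBall (0 : (EuclideanSpace ℝ (Fin 3))) r) := by
    rw [hμ, Measure.restrict_apply_univ, Measure.addHaar_closedBall_center]
  have hvol_lt : volume (closedBall (0 : (EuclideanSpace ℝ (Fin 3))) r) < ⊤ := measure_closedBall_lt_top
  have h1 : eLpNorm F 1 μ ≤ eLpNorm F q μ * μ Set.univ ^ (1 - 1 / q.toReal) := by
    have := eLpNorm_le_eLpNorm_mul_rpow_measure_univ hq hFμ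
    rwa [ENNReal.toReal_one, div_one] at this
  have h2 : eLpNorm F q μ ≤ ENNReal.ofReal B := (eLpNorm_mono_measure F Measure.restrict_le_self).trans hFq
  have hpow_lt : μ Set.univ ^ (1 - 1 / q.toReal) < ⊤ := by
    rw [hvol]
    exact ENNReal.rpow_lt_top_of_nonneg (by
      have : q.toReal = 0 ∨ 1 ≤ q.toReal := by
        rcases eq_or_ne q ⊤ with h | h
        · left; simp [h]
        · right
          have := ENNReal.toReal_mono h hq
          rwa [ENNReal.toReal_one] at this
      rcases this with h | h
      · rw [h]; norm_num
      · have : 1 / q.toReal ≤ 1 := by rw [div_le_one (by linarith)]; exact h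
        linarith) hvol_lt.ne
  have h3 : eLpNorm F 1 μ < ⊤ :=
    lt_of_le_of_lt (h1.trans (mul_le_mul' h2 le_rfl)) (ENNReal.mul_lt_top ENNReal.ofReal_lt_top hpow_lt)
  have hint : Integrable F μ := ⟨hFμ, by
    rw [hasFiniteIntegral_iff_enorm, ← eLpNorm_one_eq_lintegral_enorm]; exact h3⟩
  refine ⟨hint, ?_⟩
  rw [integral_norm_eq_lintegral_enorm hFμ, ← eLpNorm_one_eq_lintegral_enorm]
  have h4 : eLpNorm F 1 μ ≤ ENNReal.ofReal B * μ Set.univ ^ (1 - 1 / q.toReal) :=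
    h1.trans (mul_le_mul' h2 le_rfl)
  calc (eLpNorm F 1 μ).toReal ≤ (ENNReal.ofReal B * μ Set.univ ^ (1 - 1 / q.toReal)).toReal :=
        ENNReal.toReal_mono (ENNReal.mul_ne_top ENNReal.ofReal_ne_top hpow_lt.ne) h4
    _ = ((volume (closedBall (0 : (EuclideanSpace ℝ (Fin 3))) r)) ^ (1 - 1 / q.toReal)).toReal * B := by
        rw [ENNReal.toReal_mul, ENNReal.toReal_ofReal hB, hvol, mul_comm]

/-- Local `L¹` norms of `|U|²` from a global `L^q` bound on `U`, `2 ≤ q ≤ ∞`, uniformly in the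
centre: `∫_{B̄(y,r)} |U|² ≤ C_{r,q} B²` if `‖U‖_{L^q} ≤ B`. [folklore] -/
theorem setIntegral_norm_sq_le_of_eLpNorm_le {U : (EuclideanSpace ℝ (Fin 3)) → (EuclideanSpace ℝ (Fin 3))} (hU : Continuous U) {q : ℝ≥0∞}
    (hq : 2 ≤ q) {B : ℝ} (hB : 0 ≤ B) (hUq : eLpNorm U q volume ≤ ENNReal.ofReal B) (y : (EuclideanSpace ℝ (Fin 3))) (r : ℝ) :
    ∫ w in closedBall y r, ‖U w‖ ^ 2 ≤
      ((volume (closedBall (0 : (EuclideanSpace ℝ (Fin 3))) r)) ^ (1 - 1 / (q / 2).toReal)).toReal * B ^ 2 := by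
  -- `‖ |U|² ‖_{L^{q/2}} = ‖U‖²_{L^q}`
  have hF : AEStronglyMeasurable (fun w => ‖U w‖ ^ 2) volume :=
    (hU.norm.pow 2).aestronglyMeasurable
  have hq2 : 1 ≤ q / 2 := by
    rw [ENNReal.le_div_iff_mul_le (Or.inl two_ne_zero) (Or.inl ENNReal.ofNat_ne_top), one_mul]
    exact hq
  have hnorm : eLpNorm (fun w => ‖U w‖ ^ 2) (q / 2) volume = eLpNorm U q volume ^ (2 : ℝ) := by
    have h := eLpNorm_norm_rpow U (p := q / 2) (μ := volume) (q := 2) two_pos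
    have hq' : q / 2 * ENNReal.ofReal 2 = q := by
      rw [ENNReal.ofReal_ofNat, ENNReal.div_mul_cancel two_ne_zero ENNReal.ofNat_ne_top]
    rw [hq'] at h
    rw [← h]
    refine eLpNorm_congr_ae (Eventually.of_forall fun w => ?_)
    simp
  have hB2 : eLpNorm (fun w => ‖U w‖ ^ 2) (q / 2) volume ≤ ENNReal.ofReal (B ^ 2) := by
    rw [hnorm]
    calc eLpNorm U q volume ^ (2 : ℝ) ≤ ENNReal.ofReal B ^ (2 : ℝ) :=
          ENNReal.rpow_le_rpow hUq zero_le_two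
      _ = ENNReal.ofReal (B ^ 2) := by
          rw [ENNReal.rpow_two, sq, sq, ENNReal.ofReal_mul hB]
  have h := (setIntegral_norm_le_of_eLpNorm_le hF hq2 (sq_nonneg B) hB2 y r).2
  refine le_trans (le_of_eq ?_) h
  refine integral_congr_ae (Eventually.of_forall fun w => ?_)
  simp only [Real.norm_eq_abs, abs_pow, abs_norm]

/-! ### The theorem: local `L^p` control of `P` up to constants, linear in the centre -/

/-- A bounded function on a ball has small `L^p` norm: if `|f| ≤ C` on `B̄(x₀, ρ)` then
`‖f‖_{L^p(B(x₀,ρ))} ≤ |B(0, ρ)|^{1/p} C`. [folklore] -/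
theorem eLpNorm_restrict_ball_le_of_bound {f : (EuclideanSpace ℝ (Fin 3)) → ℝ} {x₀ : (EuclideanSpace ℝ (Fin 3))} {ρ C : ℝ}
    (hf : ∀ x ∈ closedBall x₀ ρ, |f x| ≤ C) (p : ℝ≥0∞) :
    eLpNorm f p (volume.restrict (ball x₀ ρ)) ≤
      (volume (ball (0 : (EuclideanSpace ℝ (Fin 3))) ρ)) ^ p.toReal⁻¹ * ENNReal.ofReal C := by
  have h := eLpNorm_le_of_ae_bound (f := f) (p := p) (μ := volume.restrict (ball x₀ ρ)) (C := C) ?_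
  · rwa [Measure.restrict_apply_univ, Measure.addHaar_ball_center] at h
  · rw [ae_restrict_iff' measurableSet_ball]
    refine Eventually.of_forall fun x hx => ?_
    rw [Real.norm_eq_abs]
    exact hf x (ball_subset_closedBall hx)

/-- **Local control of the pressure of a Leray profile up to constants** (the local form of Tsai
1998, Lemma 2.1 with (2.3)/(2.4), as consumed by Lemma 3.1 and Remark 3.1). Let `ν, a ≥ 0`,
`(U, P)` a Leray profile with `U ∈ C^∞ ∩ L^q((EuclideanSpace ℝ (Fin 3)))`, `2 ≤ q ≤ ∞`, `ρ > 0`, `1 ≤ p ≤ ∞`, and suppose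
the normalised pressures of the localised fields are bounded in `L^p` uniformly in the centre,
`‖p̃[θ_{x₀,ρ}U]‖_{L^p} ≤ B` for all `x₀`. Then there is `K` such that for **every centre `x₀`**:
`‖∇(P − p̃[θ_{x₀,ρ}U])‖ ≤ K (1 + |x₀|)` on `B̄(x₀, ρ)`, and with the constant
`c_{x₀} = (P − p̃[θ_{x₀,ρ}U])(x₀)`,
`‖P − c_{x₀}‖_{L^p(B(x₀, ρ))} ≤ K (1 + |x₀|)`. [cite: Tsai1998, Lemma 2.1 and Remark 3.1] -/
theorem IsLerayProfile.exists_local_pressure_bound (hprof : IsLerayProfile ν a U P)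
    (hU : ContDiff ℝ ∞ U) (hν : 0 ≤ ν) (ha : 0 ≤ a) (hρ : 0 < ρ) {q : ℝ≥0∞} (hq : 2 ≤ q)
    (hUq : MemLp U q volume) {p : ℝ≥0∞} (hp : 1 ≤ p) {B : ℝ} (hB : 0 ≤ B)
    (hN : ∀ x₀ : (EuclideanSpace ℝ (Fin 3)), eLpNorm (normalisedPressure (fun w : EuclideanSpace ℝ (Fin 3) =>
      cutoff (4 * ρ) (w - x₀) • U w)) p volume ≤ ENNReal.ofReal B) :
    ∃ K : ℝ, 0 ≤ K ∧ ∀ x₀ : (EuclideanSpace ℝ (Fin 3)),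
      (∀ y ∈ closedBall x₀ ρ, ‖fderiv ℝ (fun x => P x - normalisedPressure
        (fun w : EuclideanSpace ℝ (Fin 3) => cutoff (4 * ρ) (w - x₀) • U w) x) y‖ ≤ K * (1 + ‖x₀‖)) ∧
      eLpNorm (fun x => P x - (P x₀ - normalisedPressure
        (fun w : EuclideanSpace ℝ (Fin 3) => cutoff (4 * ρ) (w - x₀) • U w) x₀)) p
        (volume.restrict (ball x₀ ρ)) ≤ ENNReal.ofReal (K * (1 + ‖x₀‖)) := by
  -- the weight bounds and the uniform local bounds on `U`
  obtain ⟨M₀, M₁, M₂, hM₀, hM₁, hM₂, hl0, hl1, hl2⟩ := exists_bounds_newtonFarLaplacian hρ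
  obtain ⟨MU, hMU⟩ : ∃ MU : ℝ, 0 ≤ MU ∧ eLpNorm U q volume ≤ ENNReal.ofReal MU :=
    ⟨(eLpNorm U q volume).toReal, ENNReal.toReal_nonneg, (ENNReal.ofReal_toReal hUq.eLpNorm_ne_top).ge⟩
  have hq1 : 1 ≤ q := le_trans (by norm_num) hq
  set C₁ : ℝ := ((volume (closedBall (0 : (EuclideanSpace ℝ (Fin 3))) (2 * ρ))) ^ (1 - 1 / q.toReal)).toReal with hC₁
  set C₂ : ℝ := ((volume (closedBall (0 : (EuclideanSpace ℝ (Fin 3))) (2 * ρ))) ^ (1 - 1 / (q / 2).toReal)).toReal with hC₂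
  set C₃ : ℝ := ((volume (closedBall (0 : (EuclideanSpace ℝ (Fin 3))) (2 * ρ))) ^ (1 - 1 / p.toReal)).toReal with hC₃
  set A₁ := C₁ * MU with hA₁
  set A₂ := C₂ * MU ^ 2 with hA₂
  set A₃ := C₃ * B with hA₃
  have hA₁0 : 0 ≤ A₁ := mul_nonneg ENNReal.toReal_nonneg hMU.1
  have hA₂0 : 0 ≤ A₂ := mul_nonneg ENNReal.toReal_nonneg (sq_nonneg _)
  have hA₃0 : 0 ≤ A₃ := mul_nonneg ENNReal.toReal_nonneg hB
  have hUA₁ : ∀ y, ∫ w in closedBall y (2 * ρ), ‖U w‖ ≤ A₁ := fun y =>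
    (setIntegral_norm_le_of_eLpNorm_le hU.continuous.aestronglyMeasurable hq1 hMU.1 hMU.2 y (2 * ρ)).2
  have hUA₂ : ∀ y, ∫ w in closedBall y (2 * ρ), ‖U w‖ ^ 2 ≤ A₂ := fun y =>
    setIntegral_norm_sq_le_of_eLpNorm_le hU.continuous hq hMU.1 hMU.2 y (2 * ρ)
  -- the constant: gradient bound `G(x₀) ≤ K₁ (1 + |x₀|)`, then `L^p` bound
  set K₁ : ℝ := (ν * M₂ + a * M₀ + a * (M₁ * (1 + 3 * ρ) + 3 * M₀)) * A₁ + M₁ * A₂ + M₁ * A₃ with hK₁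
  have hK₁0 : 0 ≤ K₁ := by positivity
  set V : ℝ := ((volume (ball (0 : (EuclideanSpace ℝ (Fin 3))) ρ)) ^ p.toReal⁻¹).toReal with hV
  have hV0 : 0 ≤ V := ENNReal.toReal_nonneg
  have hVlt : (volume (ball (0 : (EuclideanSpace ℝ (Fin 3))) ρ)) ^ p.toReal⁻¹ < ⊤ :=
    ENNReal.rpow_lt_top_of_nonneg (inv_nonneg.2 ENNReal.toReal_nonneg) measure_ball_lt_top.ne
  set K : ℝ := V * ρ * K₁ + B + K₁ with hK
  refine ⟨K, by positivity, fun x₀ => ?_⟩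
  set N := normalisedPressure (fun w : EuclideanSpace ℝ (Fin 3) => cutoff (4 * ρ) (w - x₀) • U w) with hNd
  have hNc : Continuous N := (contDiff_normalisedPressure_locF hU hρ (x₀ := x₀)).continuous
  have hNA₃ : ∀ y, ∫ w in closedBall y (2 * ρ), |N w| ≤ A₃ := fun y => by
    have h := (setIntegral_norm_le_of_eLpNorm_le hNc.aestronglyMeasurable hp hB (hN x₀) y (2 * ρ)).2
    simpa only [Real.norm_eq_abs] using h
  -- gradient bound on the closed ball
  have hgrad : ∀ y ∈ closedBall x₀ ρ, ‖fderiv ℝ (fun x => P x - N x) y‖ ≤ K₁ * (1 + ‖x₀‖) := by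
    intro y hy
    have h := hprof.norm_fderiv_pressure_sub_localPressure_le hU hν ha hρ hM₀ hM₁ hM₂ hl0 hl1 hl2 hy
      (hUA₁ y) (hUA₂ y) (hNA₃ y)
    refine h.trans ?_
    rw [hK₁]
    have hx : 0 ≤ ‖x₀‖ := norm_nonneg _
    nlinarith [mul_nonneg hA₁0 hx, mul_nonneg hA₂0 hx, mul_nonneg hA₃0 hx, mul_nonneg hM₁ hA₂0,
      mul_nonneg hM₁ hA₃0, mul_nonneg (mul_nonneg ha hM₁) hA₁0, mul_nonneg hν hM₂,
      mul_nonneg ha hM₀, mul_nonneg (mul_nonneg (mul_nonneg ha hM₁) hA₁0) hx]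
  have hK₁K : K₁ ≤ K := by rw [hK]; nlinarith [mul_nonneg (mul_nonneg hV0 hρ.le) hK₁0]
  refine ⟨fun y hy => (hgrad y hy).trans (mul_le_mul_of_nonneg_right hK₁K (by positivity)), ?_⟩
  -- `L^p` bound: `P − c = (h − h(x₀)) + N` on the ball
  have hU3 : ContDiff ℝ 3 U := hU.of_le (by norm_cast)
  have hP2 : ContDiff ℝ 2 P := hprof.contDiff_two_pressure hU3
  have hN2 : ContDiff ℝ 2 N := contDiff_normalisedPressure_locF hU hρ (x₀ := x₀)
  have hh1 : ContDiff ℝ 1 (fun x => P x - N x) := (hP2.sub hN2).of_le one_le_two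
  have hmv : ∀ x ∈ closedBall x₀ ρ, |(P x - N x) - (P x₀ - N x₀)| ≤ K₁ * (1 + ‖x₀‖) * ρ := by
    intro x hx
    have h := (convex_closedBall x₀ ρ).norm_image_sub_le_of_norm_fderiv_le (f := fun x => P x - N x)
      (fun z _ => (hh1.differentiable one_ne_zero z)) hgrad (mem_closedBall_self hρ.le) hx
    rw [Real.norm_eq_abs] at h
    refine h.trans ?_
    rw [mem_closedBall, dist_eq_norm] at hx
    have : 0 ≤ K₁ * (1 + ‖x₀‖) := by positivity
    exact mul_le_mul_of_nonneg_left hx this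
  have hdecomp : (fun x => P x - (P x₀ - N x₀)) = (fun x => (P x - N x) - (P x₀ - N x₀)) + N := by
    funext x; simp only [Pi.add_apply]; ring
  rw [hdecomp]
  have hmeas1 : AEStronglyMeasurable (fun x => (P x - N x) - (P x₀ - N x₀)) (volume.restrict (ball x₀ ρ)) :=
    (hh1.continuous.sub continuous_const).aestronglyMeasurable
  have hmeas2 : AEStronglyMeasurable N (volume.restrict (ball x₀ ρ)) := hNc.aestronglyMeasurable
  calc eLpNorm ((fun x => (P x - N x) - (P x₀ - N x₀)) + N) p (volume.restrict (ball x₀ ρ))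
      ≤ eLpNorm (fun x => (P x - N x) - (P x₀ - N x₀)) p (volume.restrict (ball x₀ ρ)) +
          eLpNorm N p (volume.restrict (ball x₀ ρ)) := eLpNorm_add_le hmeas1 hmeas2 hp
    _ ≤ (volume (ball (0 : (EuclideanSpace ℝ (Fin 3))) ρ)) ^ p.toReal⁻¹ * ENNReal.ofReal (K₁ * (1 + ‖x₀‖) * ρ) +
          ENNReal.ofReal B := by
        gcongr
        · exact eLpNorm_restrict_ball_le_of_bound hmv p
        · exact (eLpNorm_mono_measure N Measure.restrict_le_self).trans (hN x₀)
    _ = ENNReal.ofReal (V * (K₁ * (1 + ‖x₀‖) * ρ) + B) := by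
        rw [ENNReal.ofReal_add (by positivity) hB, ENNReal.ofReal_mul hV0, hV,
          ENNReal.ofReal_toReal hVlt.ne]
    _ ≤ ENNReal.ofReal (K * (1 + ‖x₀‖)) := by
        refine ENNReal.ofReal_le_ofReal ?_
        rw [hK]
        nlinarith [norm_nonneg x₀, mul_nonneg hV0 hK₁0, mul_nonneg (mul_nonneg hV0 hK₁0) (norm_nonneg x₀)]

/-! ### The `L²` input for `q ≥ 4` from the tree's bound `‖p̃[w]‖_{L²} ≤ C ‖|w|²‖_{L²}` -/

/-- **Uniform `L²` bound for the localised normalised pressures when `q ≥ 4`.** For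
`U ∈ C^∞ ∩ L^q((EuclideanSpace ℝ (Fin 3)))`, `4 ≤ q ≤ ∞`, the normalised pressures `p̃[θ_{x₀,ρ}U]` are bounded in `L²`
uniformly in the centre: `‖p̃[θ_{x₀,ρ}U]‖_{L²} ≤ 27 M_λ ‖|θU|²‖_{L²} ≤ 27 M_λ ‖U‖²_{L⁴(B̄(x₀,8ρ))}
≤ 27 M_λ |B̄(0,8ρ)|^{1/2 − 2/q} ‖U‖²_{L^q}` (the tree's `eLpNorm_normalisedPressure_le`, Stein 1970
II §4.2 Thm 3 for `p = 2`, proved in `NormalisedPressureL2Bound`). [cite: Tsai1998, (2.3)–(2.4)] -/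
theorem exists_eLpNorm_two_normalisedPressure_locF_le {U : (EuclideanSpace ℝ (Fin 3)) → (EuclideanSpace ℝ (Fin 3))} (hU : ContDiff ℝ ∞ U)
    (hρ : 0 < ρ) {q : ℝ≥0∞} (hq : 4 ≤ q) (hUq : MemLp U q volume) :
    ∃ B : ℝ, 0 ≤ B ∧ ∀ x₀ : (EuclideanSpace ℝ (Fin 3)), eLpNorm (normalisedPressure (fun w : EuclideanSpace ℝ (Fin 3) =>
      cutoff (4 * ρ) (w - x₀) • U w)) 2 volume ≤ ENNReal.ofReal B := by
  -- the uniform bound on `‖U‖²_{L⁴(B̄(x₀,8ρ))}`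
  set V : ℝ≥0∞ := volume (closedBall (0 : (EuclideanSpace ℝ (Fin 3))) (8 * ρ)) with hV
  have hVlt : V < ⊤ := measure_closedBall_lt_top
  set W : ℝ≥0∞ := eLpNorm U q volume * V ^ (1 / (4 : ℝ≥0∞).toReal - 1 / q.toReal) with hW
  have hWlt : W < ⊤ := by
    refine ENNReal.mul_lt_top hUq.eLpNorm_lt_top (ENNReal.rpow_lt_top_of_nonneg ?_ hVlt.ne)
    have h4 : (4 : ℝ≥0∞).toReal = 4 := by norm_num
    rw [h4]
    rcases eq_or_ne q ⊤ with h | h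
    · simp [h]
    · have hq' : (4 : ℝ) ≤ q.toReal := by
        have := ENNReal.toReal_mono h hq
        rwa [show (4 : ℝ≥0∞).toReal = 4 by norm_num] at this
      have : 1 / q.toReal ≤ 1 / 4 := one_div_le_one_div_of_le (by norm_num) hq'
      linarith
  set B : ℝ≥0∞ := ENNReal.ofReal (27 * regLaplacianMass) * W ^ (2 : ℝ) with hB
  have hBlt : B < ⊤ := ENNReal.mul_lt_top ENNReal.ofReal_lt_top
    (ENNReal.rpow_lt_top_of_nonneg zero_le_two hWlt.ne)
  refine ⟨B.toReal, ENNReal.toReal_nonneg, fun x₀ => ?_⟩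
  rw [ENNReal.ofReal_toReal hBlt.ne]
  have hv : ContDiff ℝ ∞ (fun w : EuclideanSpace ℝ (Fin 3) => cutoff (4 * ρ) (w - x₀) • U w) :=
    contDiff_locF hU
  have hvc : HasCompactSupport (fun w : EuclideanSpace ℝ (Fin 3) => cutoff (4 * ρ) (w - x₀) • U w) :=
    hasCompactSupport_locF hρ
  refine (eLpNorm_normalisedPressure_le hv hvc).trans ?_
  rw [hB]
  gcongr
  -- `‖|θU|²‖_{L²} ≤ ‖|U|²‖_{L²(B̄(x₀,8ρ))} = ‖U‖²_{L⁴(B̄)} ≤ W²`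
  set μ := (volume : Measure (EuclideanSpace ℝ (Fin 3))).restrict (closedBall x₀ (8 * ρ)) with hμ
  have h1 : eLpNorm (fun y => ‖(fun w : EuclideanSpace ℝ (Fin 3) => cutoff (4 * ρ) (w - x₀) • U w) y‖ ^ 2) 2 volume
      ≤ eLpNorm (fun y => ‖U y‖ ^ 2) 2 μ := by
    rw [hμ, ← eLpNorm_indicator_eq_eLpNorm_restrict measurableSet_closedBall]
    refine eLpNorm_mono_real fun y => ?_
    rw [Real.norm_eq_abs, abs_pow, abs_norm]
    by_cases hy : y ∈ closedBall x₀ (8 * ρ)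
    · rw [indicator_of_mem hy]
      exact pow_le_pow_left₀ (norm_nonneg _) (norm_locF_le y) 2
    · rw [indicator_of_notMem hy, locF_eq_zero hρ fun h => hy (ball_subset_closedBall h), norm_zero,
        zero_pow two_ne_zero]
  have h2 : eLpNorm (fun y => ‖U y‖ ^ 2) 2 μ = eLpNorm U 4 μ ^ (2 : ℝ) := by
    have h := eLpNorm_norm_rpow U (p := 2) (μ := μ) (q := 2) two_pos
    have h24 : (2 : ℝ≥0∞) * ENNReal.ofReal 2 = 4 := by
      rw [ENNReal.ofReal_ofNat]; norm_num
    rw [h24] at h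
    rw [← h]
    refine eLpNorm_congr_ae (Eventually.of_forall fun w => ?_)
    simp
  have h3 : eLpNorm U 4 μ ≤ W := by
    have h := eLpNorm_le_eLpNorm_mul_rpow_measure_univ hq (hU.continuous.aestronglyMeasurable.restrict (μ := volume) (s := closedBall x₀ (8 * ρ)))
    rw [← hμ] at h
    refine h.trans ?_
    rw [hW, hμ, Measure.restrict_apply_univ, Measure.addHaar_closedBall_center, ← hV]
    gcongr
    exact Measure.restrict_le_self
  calc eLpNorm (fun y => ‖(fun w : EuclideanSpace ℝ (Fin 3) => cutoff (4 * ρ) (w - x₀) • U w) y‖ ^ 2) 2 volume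
      ≤ eLpNorm (fun y => ‖U y‖ ^ 2) 2 μ := h1
    _ = eLpNorm U 4 μ ^ (2 : ℝ) := h2
    _ ≤ W ^ (2 : ℝ) := ENNReal.rpow_le_rpow h3 zero_le_two

/-- **Local pressure control for `q ≥ 4`, unconditionally** (in the `L²` scale): for a Leray profile
with `U ∈ C^∞ ∩ L^q((EuclideanSpace ℝ (Fin 3)))`, `4 ≤ q ≤ ∞`, and `ρ > 0` there is `K` such that for every centre `x₀`,
`‖∇(P − p̃[θ_{x₀,ρ}U])‖ ≤ K (1 + |x₀|)` on `B̄(x₀, ρ)` and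
`‖P − c_{x₀}‖_{L²(B(x₀, ρ))} ≤ K (1 + |x₀|)`, `c_{x₀} = (P − p̃[θ_{x₀,ρ}U])(x₀)`. This covers Tsai's
case `q = ∞` (handled in print by BMO, (2.4) and the John–Nirenberg inequality, p. 38–39) with
linear instead of quartic growth. [cite: Tsai1998, Lemma 2.1 and Remark 3.1] -/
theorem IsLerayProfile.exists_local_pressure_bound_of_four_le (hprof : IsLerayProfile ν a U P)
    (hU : ContDiff ℝ ∞ U) (hν : 0 ≤ ν) (ha : 0 ≤ a) (hρ : 0 < ρ) {q : ℝ≥0∞} (hq : 4 ≤ q)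
    (hUq : MemLp U q volume) :
    ∃ K : ℝ, 0 ≤ K ∧ ∀ x₀ : (EuclideanSpace ℝ (Fin 3)),
      (∀ y ∈ closedBall x₀ ρ, ‖fderiv ℝ (fun x => P x - normalisedPressure
        (fun w : EuclideanSpace ℝ (Fin 3) => cutoff (4 * ρ) (w - x₀) • U w) x) y‖ ≤ K * (1 + ‖x₀‖)) ∧
      eLpNorm (fun x => P x - (P x₀ - normalisedPressure
        (fun w : EuclideanSpace ℝ (Fin 3) => cutoff (4 * ρ) (w - x₀) • U w) x₀)) 2
        (volume.restrict (ball x₀ ρ)) ≤ ENNReal.ofReal (K * (1 + ‖x₀‖)) := by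
  obtain ⟨B, hB, hN⟩ := exists_eLpNorm_two_normalisedPressure_locF_le hU hρ hq hUq
  exact hprof.exists_local_pressure_bound hU hν ha hρ (le_trans (by norm_num) hq) hUq one_le_two hB hN

end LocalPressure

end Literature.Analysis.FluidPDE

end
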